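import Mathlib
import HarnessLib
import Summits.AtomisticToContinuum.Crystallization.Theorems.PricedLinkCensusSoftFourRingsCapCertExp
import Summits.AtomisticToContinuum.Crystallization.Theorems.PricedLinkCensusSoftFourRingsCapCertD8Data
import Summits.AtomisticToContinuum.Crystallization.Theorems.PricedLinkCensusSoftFourRingsCapCertD8CheckA
import Summits.AtomisticToContinuum.Crystallization.Theorems.PricedLinkCensusSoftFourRingsCapCertD8CheckB
import Summits.AtomisticToContinuum.Crystallization.Theorems.PricedLinkCensusSoftFourRingsCapCertD8Exp1
import Summits.AtomisticToContinuum.Crystallization.Theorems.PricedLinkCensusSoftFourRingsCapCertD8Exp2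
import Summits.AtomisticToContinuum.Crystallization.Theorems.PricedLinkCensusSoftFourRingsCapCertD8Exp3
import Summits.AtomisticToContinuum.Crystallization.Theorems.PricedLinkCensusSoftFourRingsCapCertD8Exp4
import Summits.AtomisticToContinuum.Crystallization.Theorems.PricedLinkCensusSoftFourRingsCapCertD8Exp5
import Summits.AtomisticToContinuum.Crystallization.Theorems.PricedLinkCensusSoftFourRingsCapCertD8Exp6
import Summits.AtomisticToContinuum.Crystallization.Theorems.PricedLinkCensusSoftFourRingsCapCertD8Exp7
import Summits.AtomisticToContinuum.Crystallization.Theorems.PricedLinkCensusSoftFourRingsCapCertD8Exp8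
import Summits.AtomisticToContinuum.Crystallization.Theorems.PricedLinkCensusSoftFourRingsCapCertD8Exp9
import Summits.AtomisticToContinuum.Crystallization.Theorems.PricedLinkCensusSoftFourRingsCapCertD8Exp10
import Summits.AtomisticToContinuum.Crystallization.Theorems.PricedLinkCensusSoftFourRingsCapCertD8Exp11
import Summits.AtomisticToContinuum.Crystallization.Theorems.PricedLinkCensusSoftFourRingsCapCertD8Exp12
import Summits.AtomisticToContinuum.Crystallization.Theorems.PricedLinkCensusSoftFourRingsCapCertD8Exp13
import Summits.AtomisticToContinuum.Crystallization.Theorems.PricedLinkCensusSoftFourRingsCapCertD8Exp14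
import Summits.AtomisticToContinuum.Crystallization.Theorems.PricedLinkCensusSoftFourRingsCapCertD8Exp15
import Summits.AtomisticToContinuum.Crystallization.Theorems.PricedLinkCensusSoftFourRingsCapCertD8Exp16
import Summits.AtomisticToContinuum.Crystallization.Theorems.PricedLinkCensusSoftFourRingsCapCertD8Exp17
import Summits.AtomisticToContinuum.Crystallization.Theorems.PricedLinkCensusSoftFourRingsCapCertD8Exp18
import Summits.AtomisticToContinuum.Crystallization.Theorems.PricedLinkCensusSoftFourRingsCapCertD8Exp19
import Summits.AtomisticToContinuum.Crystallization.Theorems.PricedLinkCensusSoftFourRingsCapCertD8Exp20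
import Summits.AtomisticToContinuum.Crystallization.Theorems.PricedLinkCensusSoftFourRingsCapCertD8Step1
import Summits.AtomisticToContinuum.Crystallization.Theorems.PricedLinkCensusSoftFourRingsCapCertD8Step2
import Summits.AtomisticToContinuum.Crystallization.Theorems.PricedLinkCensusSoftFourRingsCapCertD8Step3
import Summits.AtomisticToContinuum.Crystallization.Theorems.PricedLinkCensusSoftFourRingsCapCertD8Step4
import Summits.AtomisticToContinuum.Crystallization.Theorems.PricedLinkCensusSoftFourRingsCapCertD8Step5
import Summits.AtomisticToContinuum.Crystallization.Theorems.PricedLinkCensusSoftFourRingsCapCertD8Step6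
import Summits.AtomisticToContinuum.Crystallization.Theorems.PricedLinkCensusSoftFourRingsCapCertD8Step7
import Summits.AtomisticToContinuum.Crystallization.Theorems.PricedLinkCensusSoftFourRingsCapCertD8Step8
import Summits.AtomisticToContinuum.Crystallization.Theorems.PricedLinkCensusSoftFourRingsCapCertD8Step9
import Summits.AtomisticToContinuum.Crystallization.Theorems.PricedLinkCensusSoftFourRingsCapCertD8Step10
import Summits.AtomisticToContinuum.Crystallization.Theorems.PricedLinkCensusSoftFourRingsCapCertD8Step11
import Summits.AtomisticToContinuum.Crystallization.Theorems.PricedLinkCensusSoftFourRingsCapCertD8Step12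
import Summits.AtomisticToContinuum.Crystallization.Theorems.PricedLinkCensusSoftFourRingsCapCertD8Step13

/-!
# Bond-to-cap certificate (Gram chains and `BondToCap`)

Route `PricedLinkCensus`, item `SoftFourRings` (stmt-AtomisticToContinuum-14234), crux `Cap.BondToCap`:
integer data / kernel checks of the pole-centred semidefinite certificate (format `CapCert`,
expansion mode of `PricedLinkCensusSoftFourRingsCapCertDefs`), produced by the seat's solver
(`work/compute/sdp`, `phase2.py`, `emit_lean2.py`).
-/

namespace Summit.AtomisticToContinuum.Crystallization.Theorems.Cap.Cert.D8

open Literature.Geometry.DiscreteGeometry Literature.Geometry.DiscreteGeometry.PolyCert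
  Literature.Geometry.DiscreteGeometry.PolyCert.SPoly

/-- A chunk check records the length side condition of its Gram block. [folklore] -/
theorem lenOK_of_chunkOK {g : GramBlk} {i0 cnt : ℕ} {Dp Dn : SPoly} (h : chunkOK g i0 cnt Dp Dn = true) :
    g.lenOK = true := by
  simp only [chunkOK, Bool.and_eq_true] at h
  exact h.1.1

set_option maxRecDepth 100000 in
/-- The basis of `theCert_gD0` has `9` monomials. [folklore] -/
theorem len_gD0 : theCert_gD0.z.length = 9 := by decide +kernel

/-- The Gram block `theCert_gD0` is well-formed (read off the first chunk check). [folklore] -/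
theorem lenOK_gD0 : theCert_gD0.lenOK = true := lenOK_of_chunkOK step_gD0_0

set_option maxRecDepth 100000 in
/-- The expansion `P_gD0_0` is the Gram form of `theCert_gD0`. [folklore] -/
theorem ok_gD0 : PartialOK theCert_gD0 9 P_gD0_0 := by
  have h := partialOK_step (partialOK_zero theCert_gD0) step_gD0_0
  exact h

set_option maxRecDepth 100000 in
/-- Nonnegativity of `P_gD0_0` on the box. [folklore] -/
theorem nonneg_gD0 (u v t : ℝ) (hu : |u| ≤ 1) (hv : |v| ≤ 1) (ht : |t| ≤ 1) : 0 ≤ eval P_gD0_0 u v t :=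
  nonneg_of_partialOK (g := theCert_gD0) lenOK_gD0 (by rw [len_gD0]; exact ok_gD0) u v t hu hv ht

set_option maxRecDepth 100000 in
/-- The basis of `theCert_gD1` has `8` monomials. [folklore] -/
theorem len_gD1 : theCert_gD1.z.length = 8 := by decide +kernel

/-- The Gram block `theCert_gD1` is well-formed (read off the first chunk check). [folklore] -/
theorem lenOK_gD1 : theCert_gD1.lenOK = true := lenOK_of_chunkOK step_gD1_0

set_option maxRecDepth 100000 in
/-- The expansion `P_gD1_0` is the Gram form of `theCert_gD1`. [folklore] -/
theorem ok_gD1 : PartialOK theCert_gD1 8 P_gD1_0 := by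
  have h := partialOK_step (partialOK_zero theCert_gD1) step_gD1_0
  exact h

set_option maxRecDepth 100000 in
/-- Nonnegativity of `P_gD1_0` on the box. [folklore] -/
theorem nonneg_gD1 (u v t : ℝ) (hu : |u| ≤ 1) (hv : |v| ≤ 1) (ht : |t| ≤ 1) : 0 ≤ eval P_gD1_0 u v t :=
  nonneg_of_partialOK (g := theCert_gD1) lenOK_gD1 (by rw [len_gD1]; exact ok_gD1) u v t hu hv ht

set_option maxRecDepth 100000 in
/-- The basis of `theCert_gb0` has `165` monomials. [folklore] -/
theorem len_gb0 : theCert_gb0.z.length = 165 := by decide +kernel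

/-- The Gram block `theCert_gb0` is well-formed (read off the first chunk check). [folklore] -/
theorem lenOK_gb0 : theCert_gb0.lenOK = true := lenOK_of_chunkOK step_gb0_0

set_option maxRecDepth 100000 in
/-- The expansion `P_gb0_10` is the Gram form of `theCert_gb0`. [folklore] -/
theorem ok_gb0 : PartialOK theCert_gb0 165 P_gb0_10 := by
  have h := partialOK_step (partialOK_step (partialOK_step (partialOK_step (partialOK_step (partialOK_step (partialOK_step (partialOK_step (partialOK_step (partialOK_step (partialOK_step (partialOK_zero theCert_gb0) step_gb0_0) step_gb0_1) step_gb0_2) step_gb0_3) step_gb0_4) step_gb0_5) step_gb0_6) step_gb0_7) step_gb0_8) step_gb0_9) step_gb0_10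
  exact h

set_option maxRecDepth 100000 in
/-- Nonnegativity of `P_gb0_10` on the box. [folklore] -/
theorem nonneg_gb0 (u v t : ℝ) (hu : |u| ≤ 1) (hv : |v| ≤ 1) (ht : |t| ≤ 1) : 0 ≤ eval P_gb0_10 u v t :=
  nonneg_of_partialOK (g := theCert_gb0) lenOK_gb0 (by rw [len_gb0]; exact ok_gb0) u v t hu hv ht

set_option maxRecDepth 100000 in
/-- The basis of `theCert_gb1` has `120` monomials. [folklore] -/
theorem len_gb1 : theCert_gb1.z.length = 120 := by decide +kernel

/-- The Gram block `theCert_gb1` is well-formed (read off the first chunk check). [folklore] -/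
theorem lenOK_gb1 : theCert_gb1.lenOK = true := lenOK_of_chunkOK step_gb1_0

set_option maxRecDepth 100000 in
/-- The expansion `P_gb1_5` is the Gram form of `theCert_gb1`. [folklore] -/
theorem ok_gb1 : PartialOK theCert_gb1 120 P_gb1_5 := by
  have h := partialOK_step (partialOK_step (partialOK_step (partialOK_step (partialOK_step (partialOK_step (partialOK_zero theCert_gb1) step_gb1_0) step_gb1_1) step_gb1_2) step_gb1_3) step_gb1_4) step_gb1_5
  exact h

set_option maxRecDepth 100000 in
/-- Nonnegativity of `P_gb1_5` on the box. [folklore] -/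
theorem nonneg_gb1 (u v t : ℝ) (hu : |u| ≤ 1) (hv : |v| ≤ 1) (ht : |t| ≤ 1) : 0 ≤ eval P_gb1_5 u v t :=
  nonneg_of_partialOK (g := theCert_gb1) lenOK_gb1 (by rw [len_gb1]; exact ok_gb1) u v t hu hv ht

set_option maxRecDepth 100000 in
/-- The basis of `theCert_gb2` has `120` monomials. [folklore] -/
theorem len_gb2 : theCert_gb2.z.length = 120 := by decide +kernel

/-- The Gram block `theCert_gb2` is well-formed (read off the first chunk check). [folklore] -/
theorem lenOK_gb2 : theCert_gb2.lenOK = true := lenOK_of_chunkOK step_gb2_0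

set_option maxRecDepth 100000 in
/-- The expansion `P_gb2_5` is the Gram form of `theCert_gb2`. [folklore] -/
theorem ok_gb2 : PartialOK theCert_gb2 120 P_gb2_5 := by
  have h := partialOK_step (partialOK_step (partialOK_step (partialOK_step (partialOK_step (partialOK_step (partialOK_zero theCert_gb2) step_gb2_0) step_gb2_1) step_gb2_2) step_gb2_3) step_gb2_4) step_gb2_5
  exact h

set_option maxRecDepth 100000 in
/-- Nonnegativity of `P_gb2_5` on the box. [folklore] -/
theorem nonneg_gb2 (u v t : ℝ) (hu : |u| ≤ 1) (hv : |v| ≤ 1) (ht : |t| ≤ 1) : 0 ≤ eval P_gb2_5 u v t :=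
  nonneg_of_partialOK (g := theCert_gb2) lenOK_gb2 (by rw [len_gb2]; exact ok_gb2) u v t hu hv ht

set_option maxRecDepth 100000 in
/-- The basis of `theCert_gb3` has `120` monomials. [folklore] -/
theorem len_gb3 : theCert_gb3.z.length = 120 := by decide +kernel

/-- The Gram block `theCert_gb3` is well-formed (read off the first chunk check). [folklore] -/
theorem lenOK_gb3 : theCert_gb3.lenOK = true := lenOK_of_chunkOK step_gb3_0

set_option maxRecDepth 100000 in
/-- The expansion `P_gb3_5` is the Gram form of `theCert_gb3`. [folklore] -/
theorem ok_gb3 : PartialOK theCert_gb3 120 P_gb3_5 := by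
  have h := partialOK_step (partialOK_step (partialOK_step (partialOK_step (partialOK_step (partialOK_step (partialOK_zero theCert_gb3) step_gb3_0) step_gb3_1) step_gb3_2) step_gb3_3) step_gb3_4) step_gb3_5
  exact h

set_option maxRecDepth 100000 in
/-- Nonnegativity of `P_gb3_5` on the box. [folklore] -/
theorem nonneg_gb3 (u v t : ℝ) (hu : |u| ≤ 1) (hv : |v| ≤ 1) (ht : |t| ≤ 1) : 0 ≤ eval P_gb3_5 u v t :=
  nonneg_of_partialOK (g := theCert_gb3) lenOK_gb3 (by rw [len_gb3]; exact ok_gb3) u v t hu hv ht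

set_option maxRecDepth 100000 in
/-- The basis of `theCert_gb4` has `120` monomials. [folklore] -/
theorem len_gb4 : theCert_gb4.z.length = 120 := by decide +kernel

/-- The Gram block `theCert_gb4` is well-formed (read off the first chunk check). [folklore] -/
theorem lenOK_gb4 : theCert_gb4.lenOK = true := lenOK_of_chunkOK step_gb4_0

set_option maxRecDepth 100000 in
/-- The expansion `P_gb4_5` is the Gram form of `theCert_gb4`. [folklore] -/
theorem ok_gb4 : PartialOK theCert_gb4 120 P_gb4_5 := by
  have h := partialOK_step (partialOK_step (partialOK_step (partialOK_step (partialOK_step (partialOK_step (partialOK_zero theCert_gb4) step_gb4_0) step_gb4_1) step_gb4_2) step_gb4_3) step_gb4_4) step_gb4_5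
  exact h

set_option maxRecDepth 100000 in
/-- Nonnegativity of `P_gb4_5` on the box. [folklore] -/
theorem nonneg_gb4 (u v t : ℝ) (hu : |u| ≤ 1) (hv : |v| ≤ 1) (ht : |t| ≤ 1) : 0 ≤ eval P_gb4_5 u v t :=
  nonneg_of_partialOK (g := theCert_gb4) lenOK_gb4 (by rw [len_gb4]; exact ok_gb4) u v t hu hv ht

set_option maxRecDepth 100000 in
/-- The basis of `theCert_gb5` has `84` monomials. [folklore] -/
theorem len_gb5 : theCert_gb5.z.length = 84 := by decide +kernel

/-- The Gram block `theCert_gb5` is well-formed (read off the first chunk check). [folklore] -/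
theorem lenOK_gb5 : theCert_gb5.lenOK = true := lenOK_of_chunkOK step_gb5_0

set_option maxRecDepth 100000 in
/-- The expansion `P_gb5_2` is the Gram form of `theCert_gb5`. [folklore] -/
theorem ok_gb5 : PartialOK theCert_gb5 84 P_gb5_2 := by
  have h := partialOK_step (partialOK_step (partialOK_step (partialOK_zero theCert_gb5) step_gb5_0) step_gb5_1) step_gb5_2
  exact h

set_option maxRecDepth 100000 in
/-- Nonnegativity of `P_gb5_2` on the box. [folklore] -/
theorem nonneg_gb5 (u v t : ℝ) (hu : |u| ≤ 1) (hv : |v| ≤ 1) (ht : |t| ≤ 1) : 0 ≤ eval P_gb5_2 u v t :=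
  nonneg_of_partialOK (g := theCert_gb5) lenOK_gb5 (by rw [len_gb5]; exact ok_gb5) u v t hu hv ht

set_option maxRecDepth 100000 in
/-- The basis of `theCert_gn0` has `165` monomials. [folklore] -/
theorem len_gn0 : theCert_gn0.z.length = 165 := by decide +kernel

/-- The Gram block `theCert_gn0` is well-formed (read off the first chunk check). [folklore] -/
theorem lenOK_gn0 : theCert_gn0.lenOK = true := lenOK_of_chunkOK step_gn0_0

set_option maxRecDepth 100000 in
/-- The expansion `P_gn0_10` is the Gram form of `theCert_gn0`. [folklore] -/
theorem ok_gn0 : PartialOK theCert_gn0 165 P_gn0_10 := by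
  have h := partialOK_step (partialOK_step (partialOK_step (partialOK_step (partialOK_step (partialOK_step (partialOK_step (partialOK_step (partialOK_step (partialOK_step (partialOK_step (partialOK_zero theCert_gn0) step_gn0_0) step_gn0_1) step_gn0_2) step_gn0_3) step_gn0_4) step_gn0_5) step_gn0_6) step_gn0_7) step_gn0_8) step_gn0_9) step_gn0_10
  exact h

set_option maxRecDepth 100000 in
/-- Nonnegativity of `P_gn0_10` on the box. [folklore] -/
theorem nonneg_gn0 (u v t : ℝ) (hu : |u| ≤ 1) (hv : |v| ≤ 1) (ht : |t| ≤ 1) : 0 ≤ eval P_gn0_10 u v t :=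
  nonneg_of_partialOK (g := theCert_gn0) lenOK_gn0 (by rw [len_gn0]; exact ok_gn0) u v t hu hv ht

set_option maxRecDepth 100000 in
/-- The basis of `theCert_gn1` has `120` monomials. [folklore] -/
theorem len_gn1 : theCert_gn1.z.length = 120 := by decide +kernel

/-- The Gram block `theCert_gn1` is well-formed (read off the first chunk check). [folklore] -/
theorem lenOK_gn1 : theCert_gn1.lenOK = true := lenOK_of_chunkOK step_gn1_0

set_option maxRecDepth 100000 in
/-- The expansion `P_gn1_5` is the Gram form of `theCert_gn1`. [folklore] -/
theorem ok_gn1 : PartialOK theCert_gn1 120 P_gn1_5 := by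
  have h := partialOK_step (partialOK_step (partialOK_step (partialOK_step (partialOK_step (partialOK_step (partialOK_zero theCert_gn1) step_gn1_0) step_gn1_1) step_gn1_2) step_gn1_3) step_gn1_4) step_gn1_5
  exact h

set_option maxRecDepth 100000 in
/-- Nonnegativity of `P_gn1_5` on the box. [folklore] -/
theorem nonneg_gn1 (u v t : ℝ) (hu : |u| ≤ 1) (hv : |v| ≤ 1) (ht : |t| ≤ 1) : 0 ≤ eval P_gn1_5 u v t :=
  nonneg_of_partialOK (g := theCert_gn1) lenOK_gn1 (by rw [len_gn1]; exact ok_gn1) u v t hu hv ht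

set_option maxRecDepth 100000 in
/-- The basis of `theCert_gn2` has `120` monomials. [folklore] -/
theorem len_gn2 : theCert_gn2.z.length = 120 := by decide +kernel

/-- The Gram block `theCert_gn2` is well-formed (read off the first chunk check). [folklore] -/
theorem lenOK_gn2 : theCert_gn2.lenOK = true := lenOK_of_chunkOK step_gn2_0

set_option maxRecDepth 100000 in
/-- The expansion `P_gn2_5` is the Gram form of `theCert_gn2`. [folklore] -/
theorem ok_gn2 : PartialOK theCert_gn2 120 P_gn2_5 := by
  have h := partialOK_step (partialOK_step (partialOK_step (partialOK_step (partialOK_step (partialOK_step (partialOK_zero theCert_gn2) step_gn2_0) step_gn2_1) step_gn2_2) step_gn2_3) step_gn2_4) step_gn2_5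
  exact h

set_option maxRecDepth 100000 in
/-- Nonnegativity of `P_gn2_5` on the box. [folklore] -/
theorem nonneg_gn2 (u v t : ℝ) (hu : |u| ≤ 1) (hv : |v| ≤ 1) (ht : |t| ≤ 1) : 0 ≤ eval P_gn2_5 u v t :=
  nonneg_of_partialOK (g := theCert_gn2) lenOK_gn2 (by rw [len_gn2]; exact ok_gn2) u v t hu hv ht

set_option maxRecDepth 100000 in
/-- The basis of `theCert_gn3` has `120` monomials. [folklore] -/
theorem len_gn3 : theCert_gn3.z.length = 120 := by decide +kernel

/-- The Gram block `theCert_gn3` is well-formed (read off the first chunk check). [folklore] -/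
theorem lenOK_gn3 : theCert_gn3.lenOK = true := lenOK_of_chunkOK step_gn3_0

set_option maxRecDepth 100000 in
/-- The expansion `P_gn3_5` is the Gram form of `theCert_gn3`. [folklore] -/
theorem ok_gn3 : PartialOK theCert_gn3 120 P_gn3_5 := by
  have h := partialOK_step (partialOK_step (partialOK_step (partialOK_step (partialOK_step (partialOK_step (partialOK_zero theCert_gn3) step_gn3_0) step_gn3_1) step_gn3_2) step_gn3_3) step_gn3_4) step_gn3_5
  exact h

set_option maxRecDepth 100000 in
/-- Nonnegativity of `P_gn3_5` on the box. [folklore] -/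
theorem nonneg_gn3 (u v t : ℝ) (hu : |u| ≤ 1) (hv : |v| ≤ 1) (ht : |t| ≤ 1) : 0 ≤ eval P_gn3_5 u v t :=
  nonneg_of_partialOK (g := theCert_gn3) lenOK_gn3 (by rw [len_gn3]; exact ok_gn3) u v t hu hv ht

set_option maxRecDepth 100000 in
/-- The basis of `theCert_gn4` has `120` monomials. [folklore] -/
theorem len_gn4 : theCert_gn4.z.length = 120 := by decide +kernel

/-- The Gram block `theCert_gn4` is well-formed (read off the first chunk check). [folklore] -/
theorem lenOK_gn4 : theCert_gn4.lenOK = true := lenOK_of_chunkOK step_gn4_0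

set_option maxRecDepth 100000 in
/-- The expansion `P_gn4_5` is the Gram form of `theCert_gn4`. [folklore] -/
theorem ok_gn4 : PartialOK theCert_gn4 120 P_gn4_5 := by
  have h := partialOK_step (partialOK_step (partialOK_step (partialOK_step (partialOK_step (partialOK_step (partialOK_zero theCert_gn4) step_gn4_0) step_gn4_1) step_gn4_2) step_gn4_3) step_gn4_4) step_gn4_5
  exact h

set_option maxRecDepth 100000 in
/-- Nonnegativity of `P_gn4_5` on the box. [folklore] -/
theorem nonneg_gn4 (u v t : ℝ) (hu : |u| ≤ 1) (hv : |v| ≤ 1) (ht : |t| ≤ 1) : 0 ≤ eval P_gn4_5 u v t :=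
  nonneg_of_partialOK (g := theCert_gn4) lenOK_gn4 (by rw [len_gn4]; exact ok_gn4) u v t hu hv ht

set_option maxRecDepth 100000 in
/-- The basis of `theCert_gn5` has `84` monomials. [folklore] -/
theorem len_gn5 : theCert_gn5.z.length = 84 := by decide +kernel

/-- The Gram block `theCert_gn5` is well-formed (read off the first chunk check). [folklore] -/
theorem lenOK_gn5 : theCert_gn5.lenOK = true := lenOK_of_chunkOK step_gn5_0

set_option maxRecDepth 100000 in
/-- The expansion `P_gn5_2` is the Gram form of `theCert_gn5`. [folklore] -/
theorem ok_gn5 : PartialOK theCert_gn5 84 P_gn5_2 := by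
  have h := partialOK_step (partialOK_step (partialOK_step (partialOK_zero theCert_gn5) step_gn5_0) step_gn5_1) step_gn5_2
  exact h

set_option maxRecDepth 100000 in
/-- Nonnegativity of `P_gn5_2` on the box. [folklore] -/
theorem nonneg_gn5 (u v t : ℝ) (hu : |u| ≤ 1) (hv : |v| ≤ 1) (ht : |t| ≤ 1) : 0 ≤ eval P_gn5_2 u v t :=
  nonneg_of_partialOK (g := theCert_gn5) lenOK_gn5 (by rw [len_gn5]; exact ok_gn5) u v t hu hv ht

/-- All `gD` expansions are nonnegative on the box. [folklore] -/
theorem v_gD : ∀ R ∈ ([P_gD0_0, P_gD1_0] : List SPoly), ∀ u v t : ℝ, |u| ≤ 1 → |v| ≤ 1 → |t| ≤ 1 → 0 ≤ eval R u v t := by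
  intro R hR u v t hu hv ht
  simp only [List.mem_cons, List.mem_nil_iff, or_false] at hR
  rcases hR with rfl | rfl
  · exact nonneg_gD0 u v t hu hv ht
  · exact nonneg_gD1 u v t hu hv ht

/-- All `gb` expansions are nonnegative on the box. [folklore] -/
theorem v_gb : ∀ R ∈ ([P_gb0_10, P_gb1_5, P_gb2_5, P_gb3_5, P_gb4_5, P_gb5_2] : List SPoly), ∀ u v t : ℝ, |u| ≤ 1 → |v| ≤ 1 → |t| ≤ 1 → 0 ≤ eval R u v t := by
  intro R hR u v t hu hv ht
  simp only [List.mem_cons, List.mem_nil_iff, or_false] at hR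
  rcases hR with rfl | rfl | rfl | rfl | rfl | rfl
  · exact nonneg_gb0 u v t hu hv ht
  · exact nonneg_gb1 u v t hu hv ht
  · exact nonneg_gb2 u v t hu hv ht
  · exact nonneg_gb3 u v t hu hv ht
  · exact nonneg_gb4 u v t hu hv ht
  · exact nonneg_gb5 u v t hu hv ht

/-- All `gn` expansions are nonnegative on the box. [folklore] -/
theorem v_gn : ∀ R ∈ ([P_gn0_10, P_gn1_5, P_gn2_5, P_gn3_5, P_gn4_5, P_gn5_2] : List SPoly), ∀ u v t : ℝ, |u| ≤ 1 → |v| ≤ 1 → |t| ≤ 1 → 0 ≤ eval R u v t := by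
  intro R hR u v t hu hv ht
  simp only [List.mem_cons, List.mem_nil_iff, or_false] at hR
  rcases hR with rfl | rfl | rfl | rfl | rfl | rfl
  · exact nonneg_gn0 u v t hu hv ht
  · exact nonneg_gn1 u v t hu hv ht
  · exact nonneg_gn2 u v t hu hv ht
  · exact nonneg_gn3 u v t hu hv ht
  · exact nonneg_gn4 u v t hu hv ht
  · exact nonneg_gn5 u v t hu hv ht

/-- The cap level numerator of the certificate. [folklore] -/
theorem theCert_cbN : theCert.cbN = 1084151 := rfl
/-- The cap level denominator of the certificate. [folklore] -/
theorem theCert_cbD : theCert.cbD = 2000000 := rfl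

/-- **The certified cap level**: every unit `p` has a direction within cosine level `1084151/2000000`. -/
theorem exists_inner_gt_level
    {X : Finset (EuclideanSpace ℝ (Fin 3))} {B : Finset (Finset (EuclideanSpace ℝ (Fin 3)))}
    (hX1 : ∀ y ∈ X, ‖y‖ = 1) (hcard : X.card = 12)
    (hsep : ∀ u ∈ X, ∀ u' ∈ X, u ≠ u' → inner ℝ u u' ≤ 1 - 1 / (2 * (101 / 100 : ℝ) ^ 2))
    (hB : ∀ T ∈ B, ∃ u ∈ X, ∃ u' ∈ X, u ≠ u' ∧ 1 - (101 / 100 : ℝ) ^ 2 / 2 ≤ inner ℝ u u' ∧ T = {u, u'})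
    (hdeg : ∀ v ∈ X, ∃ w : Fin 4 → EuclideanSpace ℝ (Fin 3), (∀ k, w k ∈ X) ∧
      Function.Injective w ∧ (∀ k, w k ≠ v) ∧
      (∀ k, ({v, w k} : Finset (EuclideanSpace ℝ (Fin 3))) ∈ B) ∧
      ∀ y, ({v, y} : Finset (EuclideanSpace ℝ (Fin 3))) ∈ B → ∃ k, y = w k)
    (hnb : ∀ u ∈ X, ∀ u' ∈ X, u ≠ u' → ({u, u'} : Finset (EuclideanSpace ℝ (Fin 3))) ∉ B →
      inner ℝ u u' < 101 / 200)
    (p : EuclideanSpace ℝ (Fin 3)) (hp : ‖p‖ = 1) :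
    ∃ x ∈ X, (1084151 : ℝ) < 2000000 * inner ℝ p x := by
  have h := exists_inner_gt_of_checkExp theCert ED EB EN [P_gD0_0, P_gD1_0] [P_gb0_10, P_gb1_5, P_gb2_5, P_gb3_5, P_gb4_5, P_gb5_2] [P_gn0_10, P_gn1_5, P_gn2_5, P_gn3_5, P_gn4_5, P_gn5_2] side_ok eD_ok eB_ok eN_ok
    checkExp_gD checkExp_gb checkExp_gn v_gD v_gb v_gn hX1 hcard hsep hB hdeg hnb p hp
  rw [theCert_cbN, theCert_cbD] at h
  push_cast at h
  exact h

end Summit.AtomisticToContinuum.Crystallization.Theorems.Cap.Cert.D8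

namespace Summit.AtomisticToContinuum.Crystallization.Theorems.Cap

open RealInnerProductSpace

/-- **`BondToCap` holds**: the twelve link directions of a charge-free site at one percent have
covering radius `< 57.175°` (no empty cap of chordal radius `0.957`), by the kernel-checked
pole-centred semidefinite certificate `Cert.D8.theCert`. -/
theorem bondToCap_holds : BondToCap := by
  intro X B hX1 hcard hsep hB _hBcard hdeg hnb p hp
  obtain ⟨x, hx, hlt⟩ := Cert.D8.exists_inner_gt_level hX1 hcard hsep hB hdeg hnb p hp
  refine ⟨x, hx, ?_⟩
  have hd : dist p x ^ 2 = 2 - 2 * ⟪p, x⟫ := by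
    rw [dist_eq_norm, ← real_inner_self_eq_norm_sq, inner_sub_left, inner_sub_right,
      inner_sub_right, real_inner_self_eq_norm_sq, real_inner_self_eq_norm_sq, hp, hX1 x hx,
      real_inner_comm p x]
    ring
  have h2 : dist p x ^ 2 < (0.957 : ℝ) ^ 2 := by rw [hd]; norm_num at hlt ⊢; linarith
  exact (pow_lt_pow_iff_left₀ dist_nonneg (by norm_num) two_ne_zero).1 h2

end Summit.AtomisticToContinuum.Crystallization.Theorems.Cap
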